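import Mathlib
import Summits.Ventures.PercRepro2.ZMeanProof

/-!
# A weight-`0` edge is no edge: the mean field and (HMF) are invariant under adjoining a closed
edge (blind cell PercRepro2, night-1 g9; NIGHT1-G9.md §4)

Adjoin to `(E, ends)` one edge `none : Option E` with endpoints `xy` and weight `0` (`ends'`, `p'`).
Every configuration of positive weight has the new edge closed, and with it closed the open graph is
that of the old configuration (`conn_ext`), so every probability of a connection event transports
(`prob_ext`: `P_{p'}(A') = P_p(ext ⁻¹' A')`), the residual shares and the rows of `X̂` agree, and
**`HMFc p' ends' = HMFc p ends`** (`HMFc_ext`), hence `HMF p' ends' ↔ HMF p ends` (`HMF_ext_iff`).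
Use: a class theorem stated for a star with `k` coins yields every face of the star (set the missing
coins to `0`) — e.g. (HMF) for `a₃` adjacent only to `a₁` and `o` from class O (StarOMain), and
for `a₃` adjacent only to `a₁` and `b` from class B (StarBMain).
-/

namespace Summit.Ventures.PercRepro2

open UnionCluster CovForm

namespace ZeroEdge

section Defs

variable {V : Type*} {E : Type*}

/-- The graph with one extra edge `none` of endpoints `xy`. -/
def ends' (ends : E → Sym2 V) (xy : Sym2 V) : Option E → Sym2 V := fun e => e.elim xy ends

/-- The weights with the new edge of weight `0`. -/
def p' {R : Type*} [Zero R] (p : E → R) : Option E → R := fun e => e.elim 0 p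

/-- A configuration extended by the closed new edge. -/
def ext (ω : Config E) : Config (Option E) := fun e => e.elim false ω

/-- The new edge has endpoints `xy`. -/
@[simp] lemma ends'_none (ends : E → Sym2 V) (xy : Sym2 V) : ends' ends xy none = xy := rfl
/-- The old edges keep their endpoints. -/
@[simp] lemma ends'_some (ends : E → Sym2 V) (xy : Sym2 V) (e : E) : ends' ends xy (some e) = ends e := rfl
/-- The new edge has weight `0`. -/
@[simp] lemma p'_none {R : Type*} [Zero R] (p : E → R) : p' p none = 0 := rfl
/-- The old edges keep their weights. -/
@[simp] lemma p'_some {R : Type*} [Zero R] (p : E → R) (e : E) : p' p (some e) = p e := rfl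
/-- The new edge is closed in the extension. -/
@[simp] lemma ext_none (ω : Config E) : ext ω none = false := rfl
/-- The old edges keep their states in the extension. -/
@[simp] lemma ext_some (ω : Config E) (e : E) : ext ω (some e) = ω e := rfl

/-- The open adjacencies of the extended configuration are those of `ω`. -/
lemma openAdj_ext (ends : E → Sym2 V) (xy : Sym2 V) (ω : Config E) (u v : V) :
    OpenAdj (ends' ends xy) (ext ω) u v ↔ OpenAdj ends ω u v := by
  constructor
  · rintro ⟨e, he, h⟩
    cases e with
    | none => simp at he
    | some e => exact ⟨e, he, h⟩
  · rintro ⟨e, he, h⟩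
    exact ⟨some e, he, h⟩

/-- The open graph of the extended configuration is that of `ω`. -/
lemma openGraph_ext (ends : E → Sym2 V) (xy : Sym2 V) (ω : Config E) :
    openGraph (ends' ends xy) (ext ω) = openGraph ends ω := by
  ext u v
  rw [openGraph_adj, openGraph_adj, openAdj_ext]

/-- **Connections transport**: `u ↔ v` in the extended configuration iff in `ω`. -/
lemma conn_ext (ends : E → Sym2 V) (xy : Sym2 V) (ω : Config E) (u v : V) :
    Conn (ends' ends xy) (ext ω) u v ↔ Conn ends ω u v := by
  unfold Conn
  rw [openGraph_ext]

/-- The cluster of the extended configuration is the cluster of `ω`. -/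
lemma cluster_ext (ends : E → Sym2 V) (xy : Sym2 V) (ω : Config E) (v : V) :
    cluster (ends' ends xy) (ext ω) v = cluster ends ω v := by
  ext u
  simp only [mem_cluster, conn_ext]

/-- The restriction to the edges not touching `W` commutes with the extension. -/
lemma restrict_ext [Fintype V] [DecidableEq V] (ends : E → Sym2 V) (xy : Sym2 V) (W : Finset V)
    (ω : Config E) :
    restrict (touches (ends' ends xy) (↑W : Set V))ᶜ (ext ω) =
      ext (restrict (touches ends (↑W : Set V))ᶜ ω) := by
  funext e
  cases e with
  | none => simp [restrict]
  | some e =>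
    have h : some e ∈ (touches (ends' ends xy) (↑W : Set V))ᶜ ↔ e ∈ (touches ends (↑W : Set V))ᶜ := by
      simp only [Set.mem_compl_iff, touches, Set.mem_setOf_eq, ends'_some]
    by_cases he : e ∈ (touches ends (↑W : Set V))ᶜ
    · rw [restrict_apply_of_mem (h.2 he), ext_some, ext_some, restrict_apply_of_mem he]
    · rw [restrict_apply_of_notMem (fun h' => he (h.1 h')), ext_some, restrict_apply_of_notMem he]

end Defs

section Prob

variable {V : Type*} {E : Type*} [Fintype E] [DecidableEq E] {R : Type*} [CommRing R]

omit [DecidableEq E] in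
/-- The weight of the extended configuration is the weight of `ω` (the new edge closed with weight
`0` contributes the factor `1`). -/
lemma weight_ext (p : E → R) (ω : Config E) : weight (p' p) (ext ω) = weight p ω := by
  unfold weight
  rw [Fintype.prod_option]
  simp [edgeFactor]

omit [DecidableEq E] in
/-- A configuration with the new edge open has weight `0`. -/
lemma weight_eq_zero_of_open (p : E → R) (ω' : Config (Option E)) (h : ω' none = true) :
    weight (p' p) ω' = 0 := by
  unfold weight
  rw [Fintype.prod_option, h]
  simp [edgeFactor]

/-- **Probabilities transport**: `P_{p'}(A') = P_p(ext ⁻¹' A')`. -/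
theorem prob_ext (p : E → R) (A' : Set (Config (Option E))) :
    prob (p' p) A' = prob p (ext ⁻¹' A') := by
  classical
  unfold prob
  rw [← Finset.sum_filter_add_sum_filter_not Finset.univ (fun ω' : Config (Option E) => ω' none = false)]
  have h0 : ∑ ω' ∈ Finset.univ.filter (fun ω' : Config (Option E) => ¬ ω' none = false),
      A'.indicator (weight (p' p)) ω' = 0 := by
    refine Finset.sum_eq_zero fun ω' hω' => ?_
    have h : ω' none = true := by
      have := (Finset.mem_filter.1 hω').2
      cases hh : ω' none
      · exact absurd hh this
      · rfl
    rw [Set.indicator_apply]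
    split_ifs
    · exact weight_eq_zero_of_open p ω' h
    · rfl
  rw [h0, add_zero]
  refine Finset.sum_nbij' (fun ω' => fun e => ω' (some e)) (fun ω => ext ω) ?_ ?_ ?_ ?_ ?_
  · intro ω' _; exact Finset.mem_univ _
  · intro ω _
    simp only [Finset.mem_filter, Finset.mem_univ, true_and, ext_none]
  · intro ω' hω'
    have h : ω' none = false := (Finset.mem_filter.1 hω').2
    funext e
    cases e with
    | none => rw [ext_none, h]
    | some e => rfl
  · intro ω _
    funext e; rfl
  · intro ω' hω'
    have h : ω' none = false := (Finset.mem_filter.1 hω').2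
    have e' : ext (fun e => ω' (some e)) = ω' := by
      funext e
      cases e with
      | none => rw [ext_none, h]
      | some e => rfl
    have hw : weight (p' p) ω' = weight p (fun e => ω' (some e)) := by
      conv_lhs => rw [← e']
      exact weight_ext p _
    rw [Set.indicator_apply, Set.indicator_apply, Set.mem_preimage, e', hw]

omit [Fintype E] [DecidableEq E] in
/-- The extended weights form a probability vector. -/
lemma isProbVec_p' [LinearOrder R] [IsStrictOrderedRing R] {p : E → R} (hp : IsProbVec p) :
    IsProbVec (p' p) := by
  refine ⟨fun e => ?_, fun e => ?_⟩
  · cases e with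
    | none => simp
    | some e => exact hp.nonneg e
  · cases e with
    | none => simp
    | some e => exact hp.le_one e

end Prob

section Events

variable {V : Type*} {E : Type*}

variable (ends : E → Sym2 V) (xy : Sym2 V)

/-- Connection events transport. -/
lemma preimage_connEvent (u v : V) : ext ⁻¹' connEvent (ends' ends xy) u v = connEvent ends u v := by
  ext ω; simp only [Set.mem_preimage, mem_connEvent, conn_ext]

/-- Avoidance events transport. -/
lemma preimage_avoidAll (s : V) (X : Finset V) :
    ext ⁻¹' avoidAll (ends' ends xy) s X = avoidAll ends s X := by
  ext ω; simp only [Set.mem_preimage, avoidAll, Set.mem_setOf_eq, conn_ext]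

/-- Cluster events transport. -/
lemma preimage_clusterEvent (v : V) (S : Set V) :
    ext ⁻¹' clusterEvent (ends' ends xy) v S = clusterEvent ends v S := by
  ext ω; simp only [Set.mem_preimage, mem_clusterEvent, cluster_ext]

/-- `PD` transports. -/
lemma preimage_PDEvent (a₁ a₂ a₃ : V) :
    ext ⁻¹' PDEvent (ends' ends xy) a₁ a₂ a₃ = PDEvent ends a₁ a₂ a₃ := by
  ext ω
  simp only [Set.mem_preimage, PDEvent, Dtilde, UnionCluster.inU, Set.mem_inter_iff,
    Set.mem_compl_iff, Set.mem_union, mem_connEvent, conn_ext]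

/-- `T` transports. -/
lemma preimage_TEvent (a₁ a₂ a₃ : V) :
    ext ⁻¹' TEvent (ends' ends xy) a₁ a₂ a₃ = TEvent ends a₁ a₂ a₃ := by
  ext ω
  simp only [Set.mem_preimage, TEvent, Set.mem_inter_iff, Set.mem_compl_iff, mem_connEvent, conn_ext]

end Events

section EventsDel

variable {V : Type*} {E : Type*} [Fintype V] [DecidableEq V]

variable (ends : E → Sym2 V) (xy : Sym2 V)

/-- Residual connection events transport. -/
lemma preimage_connDelEvent (W : Finset V) (u w : V) :
    ext ⁻¹' connDelEvent (ends' ends xy) W u w = connDelEvent ends W u w := by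
  ext ω
  simp only [Set.mem_preimage, connDelEvent, Set.mem_setOf_eq, restrict_ext, conn_ext]

/-- The residual `Q` transports. -/
lemma preimage_delQ (W : Finset V) (a₁ a₂ : V) :
    ext ⁻¹' delQ (ends' ends xy) W a₁ a₂ = delQ ends W a₁ a₂ := by
  unfold delQ
  rw [Set.preimage_compl, preimage_connDelEvent]

end EventsDel

section HMF

variable {V : Type*} {E : Type*} [Fintype E] [DecidableEq E] [Fintype V] [DecidableEq V]
  {R : Type*} [Field R] [LinearOrder R] [IsStrictOrderedRing R]

variable (p : E → R) (ends : E → Sym2 V) (xy : Sym2 V)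

omit [LinearOrder R] [IsStrictOrderedRing R] in
/-- Residual connection probabilities transport. -/
lemma delConnProb_ext (W : Finset V) (x v : V) :
    delConnProb (p' p) (ends' ends xy) W x v = delConnProb p ends W x v := by
  unfold delConnProb
  rw [prob_ext, preimage_connDelEvent]

omit [LinearOrder R] [IsStrictOrderedRing R] in
/-- Residual shares transport. -/
lemma delShareMass_ext (W : Finset V) (a₁ a₂ x v : V) :
    delShareMass (p' p) (ends' ends xy) W a₁ a₂ x v = delShareMass p ends W a₁ a₂ x v := by
  unfold delShareMass
  rw [prob_ext, Set.preimage_inter, preimage_delQ, preimage_connDelEvent]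

omit [LinearOrder R] [IsStrictOrderedRing R] in
/-- The rows of `X̂` transport. -/
lemma termW_ext (o a₁ a₂ b : V) (W : Finset V) :
    termW (p' p) (ends' ends xy) o a₁ a₂ b W = termW p ends o a₁ a₂ b W := by
  unfold termW termT termPD
  simp only [delConnProb_ext, delShareMass_ext, prob_ext, preimage_delQ]

omit [LinearOrder R] [IsStrictOrderedRing R] in
/-- The mean field `X̂` transports. -/
lemma Xhat_ext (o a₁ a₂ a₃ b : V) :
    Xhat (p' p) (ends' ends xy) o a₁ a₂ a₃ b = Xhat p ends o a₁ a₂ a₃ b := by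
  rw [Xhat_eq_sum, Xhat_eq_sum]
  refine Finset.sum_congr rfl fun W _ => ?_
  rw [prob_ext, preimage_clusterEvent, termW_ext]

omit [LinearOrder R] [IsStrictOrderedRing R] in
/-- **The cleared mean field is invariant under adjoining a weight-`0` edge.** -/
theorem HMFc_ext (o a₁ a₂ a₃ b : V) :
    HMFc (p' p) (ends' ends xy) o a₁ a₂ a₃ b = HMFc p ends o a₁ a₂ a₃ b := by
  unfold HMFc CovForm.marginC CovForm.DEF CovForm.EQo CovForm.EQ3 CovForm.EQ3o CovForm.Do massM2
    deltaT CovForm.gap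
  simp only [prob_ext, Set.preimage_inter, preimage_avoidAll, preimage_connEvent, preimage_PDEvent,
    preimage_TEvent, Xhat_ext]

omit [IsStrictOrderedRing R] in
/-- **(HMF) is invariant under adjoining a weight-`0` edge.** -/
theorem HMF_ext_iff (o a₁ a₂ a₃ b : V) :
    HMF (p' p) (ends' ends xy) o a₁ a₂ a₃ b ↔ HMF p ends o a₁ a₂ a₃ b := by
  unfold HMF
  rw [HMFc_ext]

end HMF

section Faces

variable {V : Type*} {E : Type*}

variable (ends : E → Sym2 V)

/-- The star hypothesis of the extended graph: every edge at `a₃` is `some f₁`, the new edge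
`none` (with endpoints `s(a₃, y)`), or `some f₃`. -/
lemma hstar_ext {f₁ f₃ : E} {a₃ y : V} (hstar : ∀ e, a₃ ∈ ends e → e = f₁ ∨ e = f₃) :
    ∀ e, a₃ ∈ ends' ends s(a₃, y) e → e = some f₁ ∨ e = none ∨ e = some f₃ := by
  intro e he
  cases e with
  | none => exact Or.inr (Or.inl rfl)
  | some e =>
    rcases hstar e he with h | h
    · exact Or.inl (by rw [h])
    · exact Or.inr (Or.inr (by rw [h]))

end Faces

end ZeroEdge

end Summit.Ventures.PercRepro2
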